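import Literature.NumberTheory.EllipticCurves.PAdicLFunctionPlusMult
import Summits.BirchSwinnertonDyer.Rank1Residual.F1Sign2.RhombicSymbolCongruence
import Summits.BirchSwinnertonDyer.Rank1Residual.F1Sign2.OddEvenCongruenceAtTwo
import Summits.BirchSwinnertonDyer.Rank1Residual.F1Sign2.OddEvenCongruenceMultAtTwo
import HarnessLib

/-!
# Cell `bsd-f1-sign2` (`p = 2`, non-CM) — IMC lens g1: BRANCH CONGRUENCE MOD `2Λ₂` (candidate IMC-A♮L,
# theorem-grade per the planner) and the ANALYTIC `μ = 0` CRUX AT `2` (IMC-K2μ, OPEN), with the proved glue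
# to the tree's g0 package (`OddEvenCongruenceAtTwo` = A, `…MultAtTwo` = B, `OddBranchCertificateSupply` = K3)

HONEST FRAMING (typer seat `bsd-f1-sign2-ty`; HOME `run/shared/lean/pub/bsd-f1-sign2/`, CANDIDATES.md §2
rows IMC-A♮L / IMC-K2μ / IMC-λ): STATEMENTS ONLY — predicates with bodies (`ModTwoCongruent`,
`BranchCongruenceModTwo`, `BranchCongruenceModTwoMult`, `EqualBranchLambda`, `FreeMeasureLatticeMultAtTwo`,
support `MultPackageIsPlusBranch f α`),
`@[conjecture] def`s (OPEN obligations of ours: `RhombicBranchCongruence` / `OrdinaryBranchCongruenceAtTwo` /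
`MultBranchCongruenceAtTwo` = A♮L, THEOREM-GRADE per the planner; `AnalyticMuZeroAtTwo` /
`AnalyticMuZeroMultAtTwo` = K2μ, THE OPEN CRUX; λ-form `OddEvenLambdaAtTwo`) and PROVED glue (kernel-checked, 0 sorry): `congruentBranches_of_modTwo`,
`oddEvenCongruence_of_modTwo_of_muZero : OrdinaryBranchCongruenceAtTwo → AnalyticMuZeroAtTwo →
OddEvenCongruenceAtTwo` (tree A), `oddEvenCongruenceMult_of_modTwo_of_muZero` (tree B, displayed support
hypothesis), `oddBranchCertificateSupply_of_modTwo_of_muZero` (tree K3), `oddEvenLambda_of_congruence`,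
`oddBranchCertificateSupply_of_lambda`, and the `Λ₂`-algebra `red_pfree_eq_of_rat_smul` (`red ∘ pfree` is
`ℚ^×`-rescaling invariant), `red_pfree_eq_of_modTwoCongruent` (`𝔽₂^× = 1` kills the rescaling ambiguity of
the g0 formulation). Nothing asserted, no named fact, PARTITION: none moved. Source: planner-of-record g1
sketch `HOME/MEMO-imc-data/Sketch.lean` sha16 fc83a7cf575bfb34 §§0, 1, 3 — bodies and proofs re-filed
VERBATIM. The symbol-level half (IMC-A♮sym `RhombicSymbolCongruence`, `IsRhombic`, `RhombicOfNegDisc`,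
finite layers) is the sibling file `F1Sign2/RhombicSymbolCongruence.lean`. REFUTER PASS: REF1-AUDIT-v1.md §8.3 (batch 2, 2026-08-27T15:06Z, file sha16 e1bf27aeee759c96): every closed Prop of this file **SURVIVES** (9/9 -imc v2, A1 rc 0, BC7 LIBRARY-SEARCH-ON CLEAN; REF1 CONCURS A♮-sym / A♮-L are THEOREM-GRADE with the tree's normalisations, `RhombicOfNegDisc` and `MultPackageIsPlusBranch` support-grade TRUE, K2μ = THE open crux; typing suggestion non-blocking: on `GoodSS W 2` the 2-torsion binder is redundant, §8.4). REF2 on the v2 rows: pending at filing.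

MATHEMATICS (MEMO-imc v2 §1): from the rhombic symbol congruence `[r]⁺ − [r]⁻ ≡ [1/2]⁺ (mod ℤ)` at the
`2`-power cusps, the `ω⁰` (even, `padicLFunction f α`) and `ω¹` (odd, `padicLFunctionMinusBranch f α 1`)
branches of the `2`-adic `L`-function are congruent mod `2Λ₂` (`BranchCongruenceModTwo`: the offset
`[1/2]⁺·α^{-n}(1−α^{-1})` per coset contributes `2·const·C(2ⁿ,k+1) → 0` to the `k`-th coefficient), with NO
torsion hypothesis; the only OPEN input left in g0's K2 is the analytic `μ = 0` at `2` (`AnalyticMuZeroAtTwo`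
— Greenberg's Conjecture 1.11 on the analytic side at `p = 2`, for `E[2](ℚ) = 0`, NO `Δ`-sign hypothesis),
and `BranchCongruenceModTwo ∧ μ(L⁺) = 0 → CongruentBranches` is PROVED here (at `p = 2` the
`ℚ^×`-rescaling ambiguity disappears mod `2`: `𝔽₂^× = 1`). REF1 §7's «L⁻ ≡ 0 junk door» is shut by K2μ
(A♮L ∧ K2μ force `μ(L₂⁻) = 0`), not opened.

BC5 WITNESS: top layers `n = 5, 6, 7` of ENGINE D2 (j280798): `(μ_n(S⁺), μ_n(S⁻)) = (−1,−1)` and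
`ham_n = 0` on **420/420** `Δ<0` torsion-free rows vs `μ₇ = (0,0)`, `ham_n > 0` on **146/146** `Δ>0`
torsion-free rows (MEMO-imc-data/lattice_index_out.md); raw `(μ⁺, μ⁻) = (0,0)` on 289/289 `Δ<0` rows of
`oddbranch_all.tsv` 5a0827a81e79746c (K2μ: `μ = 0` readings 0 exceptions among `E[2](ℚ) = 0` rows).
CHEAPEST FALSIFIER: as for IMC-A (`λ(L⁻_ω) ≠ λ(L⁺)` on a `Δ<0`, `E[2](ℚ)=0` ordinary/multiplicative row) —
0/221; for K2μ a certified `μ(L₂(E)) > 0` at an `E[2](ℚ) = 0` ordinary/multiplicative class — none.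
WHY NOVEL: MEMO-imc §6 / v2 §1 (analytic Kida at `D = −4` / cross-branch congruence at 2 not in print;
REF2 v2 §0: IMC-A NOVEL-AS-STATED at 2, K2 core OPEN-IN-PRINT = Greenberg 1.11 @ 2 [coates1999 p64]).

References: [MazurTateTeitelbaum1986Invent] §I.10, §I.13, §I.14; [Matsuno2008] Thm 5.1 (algebraic twin);
Greenberg LNM 1716 Conj. 1.11; HOME MEMO-imc.md, MEMO-imc-data/Sketch.lean fc83a7cf575bfb34,
REF1-AUDIT-v1.md §§3, 7, REF2-PLACEMENT-v2.md §§0–1.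
-/

set_option autoImplicit false

noncomputable section

open scoped Classical MatrixGroups ModularForm

open CongruenceSubgroup Polynomial WeierstrassCurve Literature.NumberTheory.EllipticCurves
  Literature.NumberTheory.EllipticCurves.ModularForms Literature.NumberTheory.EllipticCurves.Greenberg1999
  Literature.NumberTheory.EllipticCurves.Rank1Residual
  Summit.BirchSwinnertonDyer.Rank1Residual.X1.MuLambda Summit.BirchSwinnertonDyer.Rank1Residual.X5

namespace Summit.BirchSwinnertonDyer.Rank1Residual.F1Sign2

/-! ## §0. λ-forms of the g0 package (the g0 Props themselves are the tree's, imported above) -/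

/-- g0 λ-form (predicate): the λ-invariants of (any integral `ℚ^×`-rescalings of) the two branches agree.
A DEFINITION; nothing asserted. [cite: MazurTateTeitelbaum1986Invent, §I.13 (the branches; the λ-form is ours)] -/
def EqualBranchLambda {N : ℕ} (f : CuspForm (Gamma0 N) 2) (α : ℚ_[2]) : Prop :=
  ∀ (cp cm : ℚ) (Gp Gm : IwasawaAlgebra 2), cp ≠ 0 → cm ≠ 0 → Gp ≠ 0 → Gm ≠ 0 →
    iwasawaToPowerSeries 2 Gp = PowerSeries.C (cp : ℚ_[2]) * padicLFunction f α →
    iwasawaToPowerSeries 2 Gm = PowerSeries.C (cm : ℚ_[2]) * padicLFunctionMinusBranch f α 1 →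
    lam Gp = lam Gm

/-- **g0 λ-form `OddEvenLambdaAtTwo` at curve level** (good ordinary `2`, `Δ < 0`, no rational `2`-torsion):
`λ(L₂(E)) = λ(L₂(E, ω))` — the analytic Kida formula at `2` for the twist by `−1`. Follows from the tree's
`OddEvenCongruenceAtTwo` (`oddEvenLambda_of_congruence`). REF1 §3: SURVIVES (λ-shadow); REF2:
IN-PRINT-ASSEMBLY placement inherited from IMC-A (algebraic twin Matsuno 2008 Thm 5.1). [folklore] -/
@[conjecture] def OddEvenLambdaAtTwo : Prop :=
  ∀ (W : WeierstrassCurve ℚ) [W.IsElliptic] [W.IsGloballyMinimal],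
    IsOrdinaryAt W 2 → W.Δ < 0 → (∀ x : ℚ, ¬ HasRationalTwoTorsionX W x) →
    ∀ ⦃N : ℕ⦄ [NeZero N] (f : CuspForm (Gamma0 N) 2), IsNewformOf W f →
      EqualBranchLambda f (unitRoot W 2 : ℚ_[2])

/-- g0 λ-form, multiplicative objects (predicate): the one-term measures `msdPlusMeasureMult` /
`msdMinusMeasureMult` at `α = a₂ = ±1` generate a cyclic `ℤ₂[c]`-module (twin of the tree's
`FreeMeasureLatticeAtTwo`). A DEFINITION; nothing asserted. [folklore] -/
def FreeMeasureLatticeMultAtTwo {N : ℕ} (f : CuspForm (Gamma0 N) 2) (α : ℚ_[2]) : Prop :=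
  ∃ (n₀ : ℕ) (a₀ : ZMod (2 ^ n₀)), 1 ≤ n₀ ∧ IsUnit a₀ ∧
    msdPlusMeasureMult f α n₀ a₀ ≠ 0 ∧ msdMinusMeasureMult f α n₀ a₀ ≠ 0 ∧
    ∀ (n : ℕ) (a : ZMod (2 ^ n)), 1 ≤ n → IsUnit a →
      ∃ x y : ℤ_[2],
        msdPlusMeasureMult f α n a = ((x : ℚ_[2]) + y) * msdPlusMeasureMult f α n₀ a₀ ∧
        msdMinusMeasureMult f α n a = ((x : ℚ_[2]) - y) * msdMinusMeasureMult f α n₀ a₀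

/-! ## §1. Branch congruence mod `2Λ₂` (IMC-A♮L) and the analytic `μ = 0` crux (IMC-K2μ) -/

/-- Two bounded `2`-adic power series are **congruent mod `2Λ₂`** (predicate): both lie in `ι(Λ₂)` and their
integral lifts differ by a multiple of `2`. A DEFINITION; nothing asserted. [folklore] -/
def ModTwoCongruent (Lp Lm : PowerSeries ℚ_[2]) : Prop :=
  ∃ G D : IwasawaAlgebra 2,
    iwasawaToPowerSeries 2 G = Lp ∧ iwasawaToPowerSeries 2 D = Lm ∧ PowerSeries.C (2 : ℤ_[2]) ∣ G - D

/-- **A♮ (L-function level, good ordinary objects; predicate): the even branch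
`L₂(f,α,ω⁰) = padicLFunction f α` and the `ω¹`-branch `padicLFunctionMinusBranch f α 1` are congruent
mod `2Λ₂`.** A DEFINITION; nothing asserted. [cite: MazurTateTeitelbaum1986Invent, §I.13 (the branches)] -/
def BranchCongruenceModTwo {N : ℕ} (f : CuspForm (Gamma0 N) 2) (α : ℚ_[2]) : Prop :=
  ModTwoCongruent (padicLFunction f α) (padicLFunctionMinusBranch f α 1)

/-- The same for the multiplicative objects (one-term measures, `α = a₂ = ±1`): even branch
`padicLFunctionPlusBranchMult f α 0`, odd branch `padicLFunctionMinusBranchMult f α 1` (predicate).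
A DEFINITION; nothing asserted. [cite: MazurTateTeitelbaum1986Invent, §I.13 (multiplicative case ε(p) = 0)] -/
def BranchCongruenceModTwoMult {N : ℕ} (f : CuspForm (Gamma0 N) 2) (α : ℚ_[2]) : Prop :=
  ModTwoCongruent (padicLFunctionPlusBranchMult f α 0) (padicLFunctionMinusBranchMult f α 1)

/-- **SUPPORT `MultPackageIsPlusBranch f α` (predicate; in print per the planner: MTT 1986 §I.14 +
boundedness ⇒ uniqueness):** at a multiplicative `2` every interpolation package
`IsMultPAdicLFunctionOf f 2 α Lp` IS the constructed even branch `padicLFunctionPlusBranchMult f α 0`.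
Needed only to glue A♮L(mult) to the tree's `CongruentBranchesMult`, which quantifies over packages; it
is DISPLAYED as a hypothesis (for newforms of curves multiplicative at `2`) in
`oddEvenCongruenceMult_of_modTwo_of_muZero`, never asserted. A DEFINITION; nothing asserted.
[cite: MazurTateTeitelbaum1986Invent, §I.14 (uniqueness of the bounded measure; the packaging is ours)] -/
def MultPackageIsPlusBranch {N : ℕ} (f : CuspForm (Gamma0 N) 2) (α : ℚ_[2]) : Prop :=
  ∀ Lp : PowerSeries ℚ_[2], IsMultPAdicLFunctionOf f 2 α Lp → Lp = padicLFunctionPlusBranchMult f α 0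

/-- **CANDIDATE IMC-A♮L `RhombicBranchCongruence` (THEOREM-GRADE per the planner): rhombic ⇒ branch
congruence mod `2`** at a good ordinary or multiplicative `2` (`N`-level form; the offset
`α^{-n}(1−α^{-1})[1/2]⁺` per coset has total contribution `2·const·C(2ⁿ,k+1) → 0` to the `k`-th
coefficient); `IsRhombic f` is the sibling file's predicate. [folklore] -/
@[conjecture] def RhombicBranchCongruence : Prop :=
  ∀ ⦃N : ℕ⦄ [NeZero N] (f : CuspForm (Gamma0 N) 2) (a₂ : ℤ),
    IsNewform0 f → coeffField f = ⊥ → IsRhombic f → cuspCoeff f 2 = (a₂ : ℂ) →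
    (¬ 2 ∣ N → Odd a₂ → ∀ α : ℤ_[2], IsUnit α → (α : ℚ_[2]) ^ 2 - (a₂ : ℚ_[2]) * α + 2 = 0 →
        BranchCongruenceModTwo f (α : ℚ_[2])) ∧
    (2 ∣ N → ¬ 4 ∣ N → BranchCongruenceModTwoMult f (a₂ : ℚ_[2]))

/-- **Curve-level reading `OrdinaryBranchCongruenceAtTwo` on the leaf's carriers (good ordinary `2`):
`Δ < 0`, no rational `2`-torsion ⇒ `L₂(E) ≡ L₂(E, ω) (mod 2Λ₂)`.** [folklore] -/
@[conjecture] def OrdinaryBranchCongruenceAtTwo : Prop :=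
  ∀ (W : WeierstrassCurve ℚ) [W.IsElliptic] [W.IsGloballyMinimal],
    IsOrdinaryAt W 2 → W.Δ < 0 → (∀ x : ℚ, ¬ HasRationalTwoTorsionX W x) →
    ∀ ⦃N : ℕ⦄ [NeZero N] (f : CuspForm (Gamma0 N) 2), IsNewformOf W f →
      BranchCongruenceModTwo f (unitRoot W 2 : ℚ_[2])

/-- **Curve-level reading `MultBranchCongruenceAtTwo` (multiplicative `2`).** [folklore] -/
@[conjecture] def MultBranchCongruenceAtTwo : Prop :=
  ∀ (W : WeierstrassCurve ℚ) [W.IsElliptic] [W.IsGloballyMinimal],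
    W.HasMultiplicativeReductionAtPrime 2 → W.Δ < 0 → (∀ x : ℚ, ¬ HasRationalTwoTorsionX W x) →
    ∀ ⦃N : ℕ⦄ [NeZero N] (f : CuspForm (Gamma0 N) 2), IsNewformOf W f →
      BranchCongruenceModTwoMult f (W.frobeniusTrace 2 : ℚ_[2])

/-- **CRUX IMC-K2μ `AnalyticMuZeroAtTwo` (THE OPEN crux): analytic `μ = 0` at `2`** for the even branch at a
good ordinary `2` when `E[2]` is irreducible over `ℚ` (= no rational point of order `2`): every `G ∈ Λ₂` with
`ι G = L₂(E,T)` is NOT divisible by `2`. Greenberg's Conjecture 1.11 read on the analytic side at `p = 2`;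
NO `Δ`-sign hypothesis. REF2 v2: OPEN-IN-PRINT (posed for all `p` [coates1999 p64], proved nowhere at `2`).
Witness: raw `μ = 0` on 289/289 + 146/146 torsion-free rows.
LANDED 2026-08-28 (cell bsd-2adic, tower-1 GEN 24): **PROVED in the kernel** —
`Summit.BirchSwinnertonDyer.BirchSwinnertonDyer.Theorems.AnalyticMuTwo.analyticMuZeroAtTwo_holds : AnalyticMuZeroAtTwo` (p641779 ACCEPTED,
`Summits/BirchSwinnertonDyer/BirchSwinnertonDyer/Theorems/ByReductionTypeAtTwoAnalyticMuZeroAtTwoHolds.lean`; core p641152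
`AnalyticMuTwo.exists_norm_padicLCoeff_two_eq_one`, `muAnZeroAt_two_of_irr`; axioms propext, Classical.choice, Quot.sound; REF1 §118 kernel check
SECONDED; REF2 v32 add-1 §A4: open core (β) ORDINARY HALF CLOSED BY IMPORT, beyond-print inherited from THEOREM B of cells bsd-f3-mu, bsd-print-x8 —
not this cell's to book).  LIMITS (REF2 §A4.3 (i)–(iv)): the statement is about `f` and `padicLFunction f (unitRoot W 2)` on `Λ_f = ℤ·Ω⁺_f/2` — the
passage to `Ω_W` (Manin constant, lattice index: the TOWER doors) is NOT included; the multiplicative twin `AnalyticMuZeroMultAtTwo` (repaired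
`AnalyticMuZeroMultAtTwoR`) does NOT follow and stays OPEN-IN-PRINT; supersingular `2` untouched; `IsNewformOf W f` is a hypothesis.  The
`@[conjecture]` tag is kept (append-only attribute rule); consumers (`oddEvenCongruence_of_modTwo_of_muZero`, `…_of_rhombicOfNegDisc_of_muZero`,
att-p1 `sigmaRawS3_of_sigmaRS3_of_analyticMuZeroAtTwo`) discharge the binder with `analyticMuZeroAtTwo_holds`.
[cite: Greenberg1999, Conj. 1.11 (posed for all p; the p = 2 analytic reading is ours)] -/
@[conjecture] def AnalyticMuZeroAtTwo : Prop :=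
  ∀ (W : WeierstrassCurve ℚ) [W.IsElliptic] [W.IsGloballyMinimal],
    IsOrdinaryAt W 2 → (∀ x : ℚ, ¬ HasRationalTwoTorsionX W x) →
    ∀ ⦃N : ℕ⦄ [NeZero N] (f : CuspForm (Gamma0 N) 2), IsNewformOf W f →
    ∀ G : IwasawaAlgebra 2, iwasawaToPowerSeries 2 G = padicLFunction f (unitRoot W 2 : ℚ_[2]) →
      red G ≠ 0

/-- **K2μ, multiplicative `2`** (even branch of the one-term measure, `α = a₂`). [cite: Greenberg1999, Conj. 1.11 (posed for all p; the p = 2 multiplicative reading is ours)] -/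
@[conjecture] def AnalyticMuZeroMultAtTwo : Prop :=
  ∀ (W : WeierstrassCurve ℚ) [W.IsElliptic] [W.IsGloballyMinimal],
    W.HasMultiplicativeReductionAtPrime 2 → (∀ x : ℚ, ¬ HasRationalTwoTorsionX W x) →
    ∀ ⦃N : ℕ⦄ [NeZero N] (f : CuspForm (Gamma0 N) 2), IsNewformOf W f →
    ∀ G : IwasawaAlgebra 2,
      iwasawaToPowerSeries 2 G = padicLFunctionPlusBranchMult f (W.frobeniusTrace 2 : ℚ_[2]) 0 →
      red G ≠ 0

/-! ## §2. Proved glue (MEMO-imc-data/Sketch.lean §3, verbatim) -/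

/-- g0: `CongruentBranches ⇒ EqualBranchLambda` (`lam` is read off `red ∘ pfree`). [folklore] -/
theorem equalBranchLambda_of_congruent {N : ℕ} (f : CuspForm (Gamma0 N) 2) (α : ℚ_[2])
    (h : CongruentBranches f α) : EqualBranchLambda f α := by
  intro cp cm Gp Gm hcp hcm hGp hGm hp hm
  unfold lam
  rw [h cp cm Gp Gm hcp hcm hGp hGm hp hm]

/-- g0: `OddEvenCongruenceAtTwo ⇒ OddEvenLambdaAtTwo`. [folklore] -/
theorem oddEvenLambda_of_congruence (h : OddEvenCongruenceAtTwo) : OddEvenLambdaAtTwo := by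
  intro W _ _ hord hΔ h2 N _ f hf
  exact equalBranchLambda_of_congruent f _ (h W hord hΔ h2 f hf)

/-- A `μ`-certificate with `ϖ = 0` is impossible (`ι` injective ⇒ `G = 0`). [folklore] -/
theorem varpi_ne_zero_of_analyticMuLambda {L : PowerSeries ℚ_[2]} {ϖ : ℚ} {m n : ℕ}
    (h : AddTwoL2Pinch.AnalyticMuLambda L ϖ m n) : ϖ ≠ 0 := by
  rintro rfl
  obtain ⟨G, hG0, hG, -, -⟩ := h
  apply hG0
  apply iwasawaToPowerSeries_injective 2
  rw [hG]
  simp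

/-- g0: `OddEvenLambdaAtTwo ⇒ OddBranchCertificateSupply` (K3 from the λ-form). [folklore] -/
theorem oddBranchCertificateSupply_of_lambda (h : OddEvenLambdaAtTwo) :
    OddBranchCertificateSupply := by
  intro W _ _ hord hΔ h2 N _ f hf ϖp ϖm n m hp hm
  have hϖp := varpi_ne_zero_of_analyticMuLambda hp
  have hϖm := varpi_ne_zero_of_analyticMuLambda hm
  obtain ⟨Gp, hGp0, hGp, -, hlp⟩ := hp
  obtain ⟨Gm, hGm0, hGm, -, hlm⟩ := hm
  have := h W hord hΔ h2 f hf ϖp ϖm Gp Gm hϖp hϖm hGp0 hGm0 hGp hGm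
  omega

/-- In `Λ₂ = ℤ₂⟦T⟧` an odd integer constant reduces to `1` mod `2` (`𝔽₂^× = 1`). [folklore] -/
theorem red_intCast_of_odd {k : ℤ} (hk : Odd k) : red ((k : IwasawaAlgebra 2)) = 1 := by
  obtain ⟨j, rfl⟩ := hk
  have hC : ((2 * j + 1 : ℤ) : IwasawaAlgebra 2) = PowerSeries.C ((2 * j + 1 : ℤ) : ℤ_[2]) := by
    rw [map_intCast]
  rw [hC, red, PowerSeries.map_C]
  have h1 : IsLocalRing.residue ℤ_[2] ((2 * j + 1 : ℤ) : ℤ_[2]) = 1 := by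
    rw [← (IsLocalRing.residue ℤ_[2]).map_one]
    apply Ideal.Quotient.eq.mpr
    rw [PadicInt.maximalIdeal_eq_span_p, Ideal.mem_span_singleton]
    exact ⟨(j : ℤ_[2]), by push_cast; ring⟩
  rw [h1, map_one]

/-- `red ∘ pfree` kills nonzero integer constants: `red (pfree k) = 1` for `k ∈ ℤ ∖ {0}`. [folklore] -/
theorem red_pfree_intCast {k : ℤ} (hk : k ≠ 0) : red (pfree ((k : IwasawaAlgebra 2))) = 1 := by
  obtain ⟨a, m, hm, hkm⟩ := Nat.exists_eq_two_pow_mul_odd (Int.natAbs_ne_zero.mpr hk)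
  have hm' : Odd (m : ℤ) := by exact_mod_cast hm
  obtain ⟨k', hk'odd, hk'⟩ : ∃ k' : ℤ, Odd k' ∧ k = 2 ^ a * k' := by
    rcases Int.natAbs_eq k with h | h
    · exact ⟨m, hm', by rw [h, hkm]; push_cast; ring⟩
    · exact ⟨-m, by simpa using hm', by rw [h, hkm]; push_cast; ring⟩
  have hfac : ((k : IwasawaAlgebra 2)) =
      PowerSeries.C (((2 : ℕ) : ℤ_[2]) ^ a) * ((k' : ℤ) : IwasawaAlgebra 2) := by
    rw [hk']; push_cast; simp [map_ofNat]
  have h₀ : red (((k' : ℤ) : IwasawaAlgebra 2)) ≠ 0 := by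
    rw [red_intCast_of_odd hk'odd]; exact one_ne_zero
  rw [(mu_eq_and_pfree_eq h₀ hfac).2, red_intCast_of_odd hk'odd]

/-- `red (C 2 * E) = 0` in `𝔽₂⟦T⟧`. [folklore] -/
theorem red_C_two_mul (E : IwasawaAlgebra 2) : red (PowerSeries.C (2 : ℤ_[2]) * E) = 0 := by
  rw [red_eq_zero_iff]
  exact ⟨E, by norm_num⟩

/-- If `red g ≠ 0` then `pfree g = g` (`μ(g) = 0`). [folklore] -/
theorem pfree_eq_self_of_red_ne_zero {g : IwasawaAlgebra 2} (hg : red g ≠ 0) : pfree g = g :=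
  (mu_eq_and_pfree_eq (a := 0) hg (by simp)).2

/-- Rescaling by a nonzero rational does not change `red ∘ pfree`: if `ι G' = c · ι G` with
`c ∈ ℚ^×` then `red (pfree G') = red (pfree G)`. [folklore] -/
theorem red_pfree_eq_of_rat_smul {G G' : IwasawaAlgebra 2} {c : ℚ} (hc : c ≠ 0) (hG : G ≠ 0)
    (hG' : G' ≠ 0)
    (h : iwasawaToPowerSeries 2 G' = PowerSeries.C (c : ℚ_[2]) * iwasawaToPowerSeries 2 G) :
    red (pfree G') = red (pfree G) := by
  have hden : (c.den : ℤ) ≠ 0 := by exact_mod_cast c.den_nz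
  have hnum : c.num ≠ 0 := Rat.num_ne_zero.mpr hc
  -- clear denominators inside `Λ₂`
  have key : ((c.den : ℤ) : IwasawaAlgebra 2) * G' = ((c.num : ℤ) : IwasawaAlgebra 2) * G := by
    apply iwasawaToPowerSeries_injective 2
    rw [map_mul, map_mul, map_intCast, map_intCast, h, ← mul_assoc]
    congr 1
    have hq : ((c.den : ℤ) : ℚ_[2]) * (c : ℚ_[2]) = (c.num : ℚ_[2]) := by
      have := Rat.mul_den_eq_num c
      push_cast
      rw [mul_comm]; exact_mod_cast this
    rw [← map_intCast (PowerSeries.C (R := ℚ_[2])), ← map_mul, hq, map_intCast]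
  have hden' : ((c.den : ℤ) : IwasawaAlgebra 2) ≠ 0 := by
    intro h0; apply hden
    have : ((c.den : ℤ) : IwasawaAlgebra 2) = PowerSeries.C ((c.den : ℤ) : ℤ_[2]) := by rw [map_intCast]
    rw [this] at h0
    have h0' := congrArg PowerSeries.constantCoeff h0
    simp only [PowerSeries.constantCoeff_C, map_zero] at h0'
    exact_mod_cast h0'
  have hnum' : ((c.num : ℤ) : IwasawaAlgebra 2) ≠ 0 := by
    intro h0; apply hnum
    have : ((c.num : ℤ) : IwasawaAlgebra 2) = PowerSeries.C ((c.num : ℤ) : ℤ_[2]) := by rw [map_intCast]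
    rw [this] at h0
    have h0' := congrArg PowerSeries.constantCoeff h0
    simp only [PowerSeries.constantCoeff_C, map_zero] at h0'
    exact_mod_cast h0'
  have hred_mul : ∀ a b : IwasawaAlgebra 2, red (a * b) = red a * red b := fun a b => by
    simp [red, map_mul]
  have := congrArg (fun x => red (pfree x)) key
  simp only [pfree_mul hden' hG', pfree_mul hnum' hG, hred_mul, red_pfree_intCast hden,
    red_pfree_intCast hnum, one_mul] at this
  exact this

/-- **Glue (proved), generic form:** congruence mod `2Λ₂` + analytic `μ(Lp) = 0` ⇒ the `2`-free parts
of ANY integral `ℚ^×`-rescalings of `Lp` and `Lm` agree in `𝔽₂⟦T⟧` (at `p = 2` the rescaling ambiguity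
of the g0 formulation disappears mod `2`: `𝔽₂^× = 1`). [folklore] -/
theorem red_pfree_eq_of_modTwoCongruent {Lp Lm : PowerSeries ℚ_[2]} (h : ModTwoCongruent Lp Lm)
    (hμ : ∀ G : IwasawaAlgebra 2, iwasawaToPowerSeries 2 G = Lp → red G ≠ 0) :
    ∀ (cp cm : ℚ) (Gp Gm : IwasawaAlgebra 2), cp ≠ 0 → cm ≠ 0 → Gp ≠ 0 → Gm ≠ 0 →
      iwasawaToPowerSeries 2 Gp = PowerSeries.C (cp : ℚ_[2]) * Lp →
      iwasawaToPowerSeries 2 Gm = PowerSeries.C (cm : ℚ_[2]) * Lm →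
      red (pfree Gp) = red (pfree Gm) := by
  obtain ⟨G, D, hG, hD, E, hE⟩ := h
  have hredG : red G ≠ 0 := hμ G hG
  have hGD : red G = red D := by
    have : G = D + PowerSeries.C (2 : ℤ_[2]) * E := by rw [← hE]; ring
    rw [this, red, map_add, ← red, ← red, red_C_two_mul, add_zero]
  have hredD : red D ≠ 0 := hGD ▸ hredG
  have hG0 : G ≠ 0 := by rintro rfl; exact hredG (by simp [red])
  have hD0 : D ≠ 0 := by rintro rfl; exact hredD (by simp [red])
  intro cp cm Gp Gm hcp hcm hGp hGm hp hm
  rw [← hG] at hp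
  rw [← hD] at hm
  rw [red_pfree_eq_of_rat_smul hcp hG0 hGp hp, red_pfree_eq_of_rat_smul hcm hD0 hGm hm,
    pfree_eq_self_of_red_ne_zero hredG, pfree_eq_self_of_red_ne_zero hredD, hGD]

/-- **Glue (proved): A♮-L + K2μ ⇒ the tree's `CongruentBranches f α`** (good ordinary objects). [folklore] -/
theorem congruentBranches_of_modTwo {N : ℕ} (f : CuspForm (Gamma0 N) 2) (α : ℚ_[2])
    (h : BranchCongruenceModTwo f α)
    (hμ : ∀ G : IwasawaAlgebra 2, iwasawaToPowerSeries 2 G = padicLFunction f α → red G ≠ 0) :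
    CongruentBranches f α := by
  intro cp cm Gp Gm hcp hcm hGp hGm hp hm
  exact red_pfree_eq_of_modTwoCongruent h hμ cp cm Gp Gm hcp hcm hGp hGm hp hm

/-- **Glue (proved), multiplicative objects:** A♮-L(mult) + K2μ(mult) + package uniqueness ⇒ the
tree's `CongruentBranchesMult f α`. [folklore] -/
theorem congruentBranchesMult_of_modTwo {N : ℕ} (f : CuspForm (Gamma0 N) 2) (α : ℚ_[2])
    (h : BranchCongruenceModTwoMult f α)
    (hμ : ∀ G : IwasawaAlgebra 2,
      iwasawaToPowerSeries 2 G = padicLFunctionPlusBranchMult f α 0 → red G ≠ 0)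
    (hu : MultPackageIsPlusBranch f α) : CongruentBranchesMult f α := by
  intro Lp cp cm Gp Gm hLp hcp hcm hGp hGm hp hm
  rw [hu Lp hLp] at hp
  exact red_pfree_eq_of_modTwoCongruent h hμ cp cm Gp Gm hcp hcm hGp hGm hp hm

/-- **Curve-level corollary (proved): `OrdinaryBranchCongruenceAtTwo ∧ AnalyticMuZeroAtTwo ⇒
OddEvenCongruenceAtTwo`** — the tree's `@[conjecture]` A follows from the theorem-grade A♮-L and the
open crux K2μ (this REPLACES g0's K1 ∘ K2 assembly `oddEvenCongruenceAtTwo_of_cruxes`, whose K2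
`FreeLatticeOfConnectedRealLocus` bundled the same analytic `μ = 0` with the lattice statement). [folklore] -/
theorem oddEvenCongruence_of_modTwo_of_muZero (h₁ : OrdinaryBranchCongruenceAtTwo)
    (h₂ : AnalyticMuZeroAtTwo) : OddEvenCongruenceAtTwo := by
  intro W _ _ hord hΔ h2 N _ f hf
  exact congruentBranches_of_modTwo f _ (h₁ W hord hΔ h2 f hf) (h₂ W hord h2 f hf)

/-- Multiplicative twin (proved): `MultBranchCongruenceAtTwo ∧ AnalyticMuZeroMultAtTwo ∧ (package
uniqueness, displayed) ⇒ OddEvenCongruenceMultAtTwo` (tree's B). [folklore] -/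
theorem oddEvenCongruenceMult_of_modTwo_of_muZero (h₁ : MultBranchCongruenceAtTwo)
    (h₂ : AnalyticMuZeroMultAtTwo)
    (hu : ∀ (W : WeierstrassCurve ℚ) [W.IsElliptic] [W.IsGloballyMinimal],
      W.HasMultiplicativeReductionAtPrime 2 → ∀ ⦃N : ℕ⦄ [NeZero N] (f : CuspForm (Gamma0 N) 2),
      IsNewformOf W f → MultPackageIsPlusBranch f (W.frobeniusTrace 2 : ℚ_[2])) :
    OddEvenCongruenceMultAtTwo := by
  intro W _ _ hmult hΔ h2 N _ f hf
  exact congruentBranchesMult_of_modTwo f _ (h₁ W hmult hΔ h2 f hf) (h₂ W hmult h2 f hf) (hu W hmult f hf)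

/-- **K3 from the g1 package (proved chain):** A♮-L + K2μ ⇒ A ⇒ λ-form ⇒ `OddBranchCertificateSupply`. [folklore] -/
theorem oddBranchCertificateSupply_of_modTwo_of_muZero (h₁ : OrdinaryBranchCongruenceAtTwo)
    (h₂ : AnalyticMuZeroAtTwo) : OddBranchCertificateSupply :=
  oddBranchCertificateSupply_of_lambda
    (oddEvenLambda_of_congruence (oddEvenCongruence_of_modTwo_of_muZero h₁ h₂))

end Summit.BirchSwinnertonDyer.Rank1Residual.F1Sign2

end
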